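import Summits.BirchSwinnertonDyer.BirchSwinnertonDyer.Theorems.ErratumRoadFiveTateTorsionRigidityCurve
import Literature.NumberTheory.EllipticCurves.ZpExtension
import HarnessLib

/-!
# Route `ErratumRoadFive` (K2, `p ≥ 5`), crux (T) `Rest3TorsionBranchAtFive` (item
# stmt-BirchSwinnertonDyer-19702): Lemma (L1) of THEOREM T♭ ON A `ℤ_p`-TOWER — for every `ℤ_p`-extension
# `L_∞/ℚ_p` (`p` odd) and every `E/ℚ` split multiplicative at `p`: `E(L_∞)[p^∞] = E(ℚ_p)[p^∞]`

Cell `bsd-stepL` (run/shared/lean/pub/bsd-stepL/), seat `bsd-stepL-bdp` (prover g14, 2026-08-26), memo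
`HOME/proof/PROOF-BDP.md` §31.2 / §32; `--supports stmt-BirchSwinnertonDyer-19702 --as helper`. Fourth
file of the (L1) chain (`…TateTorsionRigidity` → `…Padic` → `…Curve` → THIS): the two «meta» hypotheses of
the chain — `H ⊴ G_{ℚ_p}` NORMAL and «every `H`-fixed element of `ℚ̄_p` has `p`-power degree» — are
DISCHARGED for `H = ker κ`, `κ : Γ_{ℚ_p} ↠ ℤ_p` a `ℤ_p`-extension in the tree's choice-free currency
`Literature.NumberTheory.EllipticCurves.ZpExtension` (Washington §13.1). This is exactly the shape of the
anticyclotomic LOCAL tower `K_{∞,w}/K_𝔭 = ℚ_p` of the erratum road at a split `𝔭` (a `ℤ_p`-extension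
of `ℚ_p`, generally ramified, neither cyclotomic nor unramified — the statement is uniform in `κ`).

* `exists_natDegree_minpoly_eq_pow_of_fixed_kerSubgroup` — for ANY field `K` of characteristic `0` and
  any `ℤ_p`-extension `κ` of `K`: an element of `K̄` fixed by `ker κ` has degree `p^j` over `K`. Proof:
  its stabiliser `S ⊇ ker κ` has finite index (finite orbit ⊆ roots of the minimal polynomial), so
  `κ(S) ≤ ℤ_p` has the same finite index `N = p^a·n'`, `p ∤ n'`; every finite-index subgroup of `ℤ_p`
  contains `N ℤ_p = p^a ℤ_p` (`n'` is a unit) — `exists_prime_pow_mul_mem_of_index_ne_zero` —, hence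
  `S ⊇ κ⁻¹(p^a ℤ_p)` and `x` lies in the layer `K_a`, of degree `p^a` (the tree's `finrank_layer_holds`);
  `[K(x):K] ∣ p^a`.
* `zpTower_curve_smul_eq_self_of_fixed_of_torsion` ∕ `zpTower_curve_exists_generator_fixed_torsion` —
  **(L1) as the memo uses it**: `p` odd, `κ` a `ℤ_p`-extension of `ℚ_p`, `E/ℚ` split multiplicative at
  `p`: every `ker κ`-fixed `p`-power-torsion point of `E(ℚ̄_p)` is `Gal(ℚ̄_p/ℚ_p)`-fixed, and they form a
  cyclic group of order `p^k` on one `ℚ_p`-rational generator (`k` from `(E, p)` alone);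
  `zpTower_branchT_…` — the same in branch (T)'s binders; `zpTower_tate_…` — for `tateCurve q`.

HONEST FRAMING: theorems only (no definition, no named fact, no `sorry`), fact-free; nothing about
Selmer groups or preprints is asserted; nothing is booked; no census word, tier or label moves (T7).
NOT here: the identification of the erratum road's `K_{∞,w}` with `ℚ̄_p^{ker κ}` for a specific `κ`
(the global-to-local restriction of the anticyclotomic character to the decomposition group at `w`; the
tree's `X11b/Anticyclotomic*` files carry that bookkeeping for the (iv)-road), Shapiro, and T♭'s Selmer
bookkeeping (objects absent).

References: [Washington1997] §13.1; [SilvermanATAEC1994] Thm. V.3.1 (c)(d), V.5.3; [Castella2018Erratum]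
Lemma 2.1, Remark (2); memo PROOF-BDP §31.2, §32.
-/

set_option autoImplicit false
-- the Theorems namespace of this sub repeats the summit name by design (D-0017 nested layout)
set_option linter.dupNamespace false

noncomputable section

open scoped Classical IntermediateField

namespace Summit.BirchSwinnertonDyer.BirchSwinnertonDyer.Theorems.TateTorsionRigidity

open Field Polynomial WeierstrassCurve Literature.NumberTheory.EllipticCurves
  Literature.NumberTheory.EllipticCurves.TateCurve Literature.NumberTheory.EllipticCurves.SteinWuthrich2013

universe u

/-! ### §1 Finite-index subgroups of `ℤ_p` and degrees in a `ℤ_p`-extension -/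

section General

variable {p : ℕ} [hp : Fact p.Prime]

/-- **Every finite-index subgroup of `ℤ_p` contains some `p^a ℤ_p`**: if `B ≤ ℤ_p` (written
multiplicatively) has finite index `N = p^a · n'` with `p ∤ n'`, then `N ℤ_p = p^a ℤ_p ⊆ B` (`n'` is a unit
of `ℤ_p`; `B ⊇ N ℤ_p` by Lagrange, `Subgroup.pow_index_mem`). So finite quotients of `ℤ_p` are `p`-groups —
abstractly, no topology. [folklore] -/
theorem exists_prime_pow_mul_mem_of_index_ne_zero (B : Subgroup (Multiplicative ℤ_[p]))
    (hB : B.index ≠ 0) :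
    ∃ a : ℕ, ∀ z : ℤ_[p], Multiplicative.ofAdd ((p : ℤ_[p]) ^ a * z) ∈ B := by
  obtain ⟨a, n', hn', hN⟩ := Nat.exists_eq_pow_mul_and_not_dvd hB p hp.out.one_lt.ne'
  refine ⟨a, fun z => ?_⟩
  haveI : B.Normal := ⟨fun n hn g => by rwa [mul_comm g n, mul_inv_cancel_right]⟩
  have hu : IsUnit ((n' : ℕ) : ℤ_[p]) :=
    PadicInt.isUnit_iff.mpr (PadicInt.norm_natCast_eq_one_iff.mpr
      ((Nat.Prime.coprime_iff_not_dvd hp.out).mpr hn'))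
  obtain ⟨u, hu'⟩ := hu
  have h := Subgroup.pow_index_mem B (Multiplicative.ofAdd ((↑u⁻¹ : ℤ_[p]) * z))
  rw [hN, ← ofAdd_nsmul, nsmul_eq_mul, Nat.cast_mul, Nat.cast_pow, ← hu'] at h
  convert h using 2
  rw [mul_assoc, ← mul_assoc (u : ℤ_[p]), Units.mul_inv, one_mul]

variable {K : Type u} [Field K] [CharZero K]

omit [CharZero K] in
/-- `ker κ ⊴ Γ_K` is normal (a kernel). [folklore] -/
theorem kerSubgroup_normal (κ : ZpExtension K p) : κ.kerSubgroup.Normal :=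
  inferInstanceAs (κ.toContinuousMonoidHom.toMonoidHom.ker).Normal

/-- **Degrees in a `ℤ_p`-extension are powers of `p`** (Washington §13.1: the subextensions of
`K_∞/K` are the layers `K_n`, `[K_n : K] = p^n`): for a field `K` of characteristic `0`, a `ℤ_p`-extension
`κ : Γ_K ↠ ℤ_p` and `x ∈ K̄` fixed by `ker κ` (i.e. `x ∈ K_∞`), `[K(x) : K] = deg (minpoly_K x) = p^j`. Proof
in the module docstring (stabiliser of finite index ⊇ `ker κ` ⟹ ⊇ `κ⁻¹(p^a ℤ_p)` ⟹ `x ∈ K_a`, and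
`[K(x):K] ∣ [K_a:K] = p^a` by the tree's `ZpExtension.finrank_layer_holds`). This is the hypothesis `hdeg`
of the (L1) chain. [cite: Washington1997, §13.1] -/
theorem exists_natDegree_minpoly_eq_pow_of_fixed_kerSubgroup (κ : ZpExtension K p)
    (x : AlgebraicClosure K) (hx : ∀ τ ∈ κ.kerSubgroup, τ • x = x) :
    ∃ j : ℕ, (minpoly K x).natDegree = p ^ j := by
  let S : Subgroup (absoluteGaloisGroup K) := MulAction.stabilizer (absoluteGaloisGroup K) x
  have hkerS : κ.kerSubgroup ≤ S := fun τ hτ => hx τ hτ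
  have hint : IsIntegral K x := Algebra.IsIntegral.isIntegral x
  -- the orbit of `x` is finite (roots of the minimal polynomial), so `S` has finite index
  have horb : (MulAction.orbit (absoluteGaloisGroup K) x).Finite := by
    refine ((minpoly K x).rootSet_finite (AlgebraicClosure K)).subset ?_
    rintro _ ⟨σ, rfl⟩
    rw [Polynomial.mem_rootSet]
    refine ⟨minpoly.ne_zero hint, ?_⟩
    show aeval (absoluteGaloisGroup.toAlgEquiv K σ x) (minpoly K x) = 0
    rw [← minpoly.algEquiv_eq (absoluteGaloisGroup.toAlgEquiv K σ) x]
    exact minpoly.aeval K _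
  have hSidx : S.index ≠ 0 := by
    rw [MulAction.index_stabilizer]
    exact ((Set.ncard_pos horb).mpr ⟨x, MulAction.mem_orbit_self x⟩).ne'
  -- the image `κ(S) ≤ ℤ_p` has the same index
  let f : absoluteGaloisGroup K →* Multiplicative ℤ_[p] := κ.toContinuousMonoidHom.toMonoidHom
  have hf : Function.Surjective f := κ.surjective
  have hker : f.ker ≤ S := hkerS
  have hBidx : (S.map f).index = S.index := by
    rw [Subgroup.index_map, sup_eq_left.mpr hker, MonoidHom.range_eq_top.mpr hf, Subgroup.index_top,
      mul_one]
  obtain ⟨a, ha⟩ := exists_prime_pow_mul_mem_of_index_ne_zero (S.map f) (hBidx ▸ hSidx)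
  -- hence `κ⁻¹(p^a ℤ_p) ≤ S`: `x` lies in the layer `K_a`
  have hlay : κ.layerSubgroup a ≤ S := by
    intro σ hσ
    rw [ZpExtension.mem_layerSubgroup] at hσ
    obtain ⟨z, hz⟩ := hσ
    have hfσ : f σ = Multiplicative.ofAdd ((p : ℤ_[p]) ^ a * z) := by
      apply Multiplicative.toAdd.injective
      rw [toAdd_ofAdd, ← hz]
      rfl
    obtain ⟨s, hs, hfs⟩ := (Subgroup.mem_map.mp (hfσ ▸ ha z) : ∃ s ∈ S, f s = f σ)
    have hmem : σ * s⁻¹ ∈ S := hker (by rw [MonoidHom.mem_ker, map_mul, map_inv, hfs, mul_inv_cancel])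
    simpa using S.mul_mem hmem hs
  have hxlay : x ∈ κ.layer a := by
    change x ∈ IntermediateField.fixedField _
    rw [IntermediateField.mem_fixedField_iff]
    rintro φ ⟨σ, hσ, rfl⟩
    exact hlay hσ
  -- degrees: `[K(x):K] ∣ [K_a:K] = p^a`
  have hfin : Module.finrank K (κ.layer a) = p ^ a := κ.finrank_layer_holds a
  have hadj : Module.finrank K K⟮x⟯ = (minpoly K x).natDegree := IntermediateField.adjoin.finrank hint
  have hle : K⟮x⟯ ≤ κ.layer a := IntermediateField.adjoin_simple_le_iff.mpr hxlay
  have hdvd : (minpoly K x).natDegree ∣ p ^ a := by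
    rw [← hadj, ← hfin]
    exact IntermediateField.finrank_dvd_of_le_right hle
  obtain ⟨j, -, hj⟩ := (Nat.dvd_prime_pow hp.out).mp hdvd
  exact ⟨j, hj⟩

end General

/-! ### §2 (L1) on a `ℤ_p`-tower over `ℚ_p` -/

section Padic

variable {p : ℕ} [Fact p.Prime]

/-- **(L1) for the Tate curve on a `ℤ_p`-tower**: `p` odd, `q ∈ ℚ_p` with `0 < ‖q‖ < 1`, `κ` ANY
`ℤ_p`-extension of `ℚ_p` (`L_∞ = ℚ̄_p^{ker κ}`): every `ker κ`-fixed `p`-power-torsion point of `E_q(ℚ̄_p)` is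
`Gal(ℚ̄_p/ℚ_p)`-fixed — `E_q(L_∞)[p^∞] = E_q(ℚ_p)[p^∞]`. [cite: SilvermanATAEC1994, Thm. V.3.1 (c),(d) (PDF pp. 395–399)] -/
theorem zpTower_tate_smul_eq_self_of_fixed_of_torsion (hp2 : p ≠ 2) (κ : ZpExtension ℚ_[p] p)
    (q : ℚ_[p]) (hq0 : q ≠ 0) (hq1 : ‖q‖ < 1)
    (P : geomPoints (tateCurve q)) {n : ℕ} (hP : (p ^ n) • P = 0)
    (hfix : ∀ τ ∈ κ.kerSubgroup, τ • P = P) (σ : absoluteGaloisGroup ℚ_[p]) : σ • P = P :=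
  haveI := kerSubgroup_normal κ
  padic_smul_eq_self_of_fixed_of_torsion hp2 q hq0 hq1 κ.kerSubgroup
    (fun x hx => exists_natDegree_minpoly_eq_pow_of_fixed_kerSubgroup κ x hx) P hP hfix σ

/-- **(L1) for the curve on a `ℤ_p`-tower (memo §31.2, the form THEOREM T♭ uses).** `p` an odd prime,
`κ` ANY `ℤ_p`-extension of `ℚ_p` with top field `L_∞ = ℚ̄_p^{ker κ}` (e.g. the anticyclotomic local tower
`K_{∞,w}/K_𝔭 = ℚ_p` at a split erratum prime), `E = W/ℚ` with SPLIT multiplicative reduction at `p`: every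
`ker κ`-fixed `p`-power-torsion point of `E(ℚ̄_p)` is `Gal(ℚ̄_p/ℚ_p)`-fixed —
**`E(L_∞)[p^∞] = E(ℚ_p)[p^∞]`**: no `p`-power torsion is acquired anywhere up the tower, so the control
defect of the (iv)-free erratum road is bounded independently of the layer. Hypothesis-minimal: no
normality or degree hypothesis is left (both discharged from `κ`).
[cite: SilvermanATAEC1994, Thm. V.5.3 (PDF pp. 407–409)] [cite: Washington1997, §13.1] -/
theorem zpTower_curve_smul_eq_self_of_fixed_of_torsion (hp2 : p ≠ 2) (κ : ZpExtension ℚ_[p] p)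
    (W : WeierstrassCurve ℚ) [W.IsElliptic] (hsplit : W.HasSplitMultiplicativeReductionAtPrime p)
    (P : geomPoints (W.baseChange ℚ_[p])) {n : ℕ} (hP : (p ^ n) • P = 0)
    (hfix : ∀ τ ∈ κ.kerSubgroup, τ • P = P) (σ : absoluteGaloisGroup ℚ_[p]) : σ • P = P :=
  haveI := kerSubgroup_normal κ
  curve_smul_eq_self_of_fixed_of_torsion hp2 W hsplit κ.kerSubgroup
    (fun x hx => exists_natDegree_minpoly_eq_pow_of_fixed_kerSubgroup κ x hx) P hP hfix σ

/-- **(L1) on a `ℤ_p`-tower, structure form**: with `κ`, `W` as above there are `k : ℕ` and ONE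
`Gal(ℚ̄_p/ℚ_p)`-fixed point `P₀ ∈ E(ℚ̄_p)` of exact order `p^k` such that every `ker κ`-fixed
`p`-power-torsion point is an integer multiple of `P₀`: `E(L_∞)[p^∞] = E(L_n)[p^∞] = E(ℚ_p)[p^∞] ≅ ℤ/p^k`
for every layer — `#H⁰(K_{∞,w}, E[p^∞]) = p^k`, the constant `c₀` of memo §31.2 (E).
[cite: SilvermanATAEC1994, Thm. V.5.3 (PDF pp. 407–409)] [cite: Washington1997, §13.1] -/
theorem zpTower_curve_exists_generator_fixed_torsion (hp2 : p ≠ 2) (κ : ZpExtension ℚ_[p] p)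
    (W : WeierstrassCurve ℚ) [W.IsElliptic] (hsplit : W.HasSplitMultiplicativeReductionAtPrime p) :
    ∃ (k : ℕ) (P₀ : geomPoints (W.baseChange ℚ_[p])),
      (∀ σ : absoluteGaloisGroup ℚ_[p], σ • P₀ = P₀) ∧ (p ^ k) • P₀ = 0 ∧
      (∀ j : ℕ, j • P₀ = 0 → p ^ k ∣ j) ∧
      ∀ (P : geomPoints (W.baseChange ℚ_[p])) (n : ℕ), (p ^ n) • P = 0 →
        (∀ τ ∈ κ.kerSubgroup, τ • P = P) → ∃ j : ℤ, P = j • P₀ :=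
  haveI := kerSubgroup_normal κ
  curve_exists_generator_fixed_torsion hp2 W hsplit κ.kerSubgroup
    (fun x hx => exists_natDegree_minpoly_eq_pow_of_fixed_kerSubgroup κ x hx)

/-- **(L1) on a `ℤ_p`-tower, branch (T) binders** (item 19702: a multiplicative `p ≥ 3` with a non-zero
`p`-torsion point of `E(ℚ_p)`, which forces split reduction): for every `ℤ_p`-extension of `ℚ_p`, the
`ker κ`-fixed `p`-power torsion of `E(ℚ̄_p)` is `ℚ_p`-rational. [cite: Castella2018Erratum, Lemma 2.1 and Remark (2) (p. 2)]
[cite: Washington1997, §13.1] -/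
theorem zpTower_branchT_smul_eq_self_of_fixed_of_torsion (κ : ZpExtension ℚ_[p] p)
    (W : WeierstrassCurve ℚ) [W.IsElliptic] [W.IsGloballyMinimal] (hp3 : 3 ≤ p)
    (hmult : Literature.NumberTheory.EllipticCurves.Rank1Residual.Mult W p)
    (hT : ∃ P : (W.baseChange ℚ_[p]).toAffine.Point, p • P = 0 ∧ P ≠ 0)
    (P : geomPoints (W.baseChange ℚ_[p])) {n : ℕ} (hP : (p ^ n) • P = 0)
    (hfix : ∀ τ ∈ κ.kerSubgroup, τ • P = P) (σ : absoluteGaloisGroup ℚ_[p]) : σ • P = P :=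
  haveI := kerSubgroup_normal κ
  branchT_smul_eq_self_of_fixed_of_torsion W hp3 hmult hT κ.kerSubgroup
    (fun x hx => exists_natDegree_minpoly_eq_pow_of_fixed_kerSubgroup κ x hx) P hP hfix σ

/-- Branch (T) binders, structure form: `∃ k P₀` as in `zpTower_curve_exists_generator_fixed_torsion`.
[cite: Castella2018Erratum, Lemma 2.1 and Remark (2) (p. 2)] [cite: Washington1997, §13.1] -/
theorem zpTower_branchT_exists_generator_fixed_torsion (κ : ZpExtension ℚ_[p] p)
    (W : WeierstrassCurve ℚ) [W.IsElliptic] [W.IsGloballyMinimal] (hp3 : 3 ≤ p)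
    (hmult : Literature.NumberTheory.EllipticCurves.Rank1Residual.Mult W p)
    (hT : ∃ P : (W.baseChange ℚ_[p]).toAffine.Point, p • P = 0 ∧ P ≠ 0) :
    ∃ (k : ℕ) (P₀ : geomPoints (W.baseChange ℚ_[p])),
      (∀ σ : absoluteGaloisGroup ℚ_[p], σ • P₀ = P₀) ∧ (p ^ k) • P₀ = 0 ∧
      (∀ j : ℕ, j • P₀ = 0 → p ^ k ∣ j) ∧
      ∀ (P : geomPoints (W.baseChange ℚ_[p])) (n : ℕ), (p ^ n) • P = 0 →
        (∀ τ ∈ κ.kerSubgroup, τ • P = P) → ∃ j : ℤ, P = j • P₀ :=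
  haveI := kerSubgroup_normal κ
  branchT_exists_generator_fixed_torsion W hp3 hmult hT κ.kerSubgroup
    (fun x hx => exists_natDegree_minpoly_eq_pow_of_fixed_kerSubgroup κ x hx)

end Padic

end Summit.BirchSwinnertonDyer.BirchSwinnertonDyer.Theorems.TateTorsionRigidity

end
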